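import Summits.NavierStokesRegularity.TurbBounds.LegendreTriple
import Summits.NavierStokesRegularity.TurbBounds.LegendreTails
import HarnessLib

/-!
# The coupling term `∫ g·V·Θ` for a polynomial profile `g` of degree `≤ P`: exact tracked part + tail remainder (rbsdp SPEC 3.5)
(cell `pub-turb` / `turb-bounds`; v2 groundwork for the `P > 0` tail lemmas.)

HONEST FRAMING: rigorous bounds for the stated PDE and boundary conditions; no claim about physical turbulence beyond the bound.
PROVED: with `pairWeight P ĝ n m = Σ_{p≤P} ĝ_p·w_m·T(p,n,m) = ∫ g P_n P_m` (`integral_g_legendre_legendre`) and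
`couplingExact N P ĝ b e = Σ_{n,m ≤ N+P, n ≤ N ∨ m ≤ N} b_n e_m pairWeight` (the index set `S` of SPEC 3.5 — exact bilinear form in the
tracked coefficients), for all real polynomials `V, Θ`:
`∫_{-1}^1 g V Θ = couplingExact N P ĝ (ĉ(V)) (ĉ(Θ)) + ∫_{-1}^1 g·w̃₀·θ̃₀` (`coupling_split`), where `w̃₀ = legTail N V`, `θ̃₀ = legTail N Θ`
are the Legendre tails beyond degree `N` — 'the coupling remainder is EXACTLY `2∫ g w̃₀ θ̃₀` (bilinearity)'. Key input: modes `n ≤ N`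
and `m > N+P` do not couple through a degree-`≤ P` profile (`LegendreTriple.tripleCoeff_eq_zero_of_far`).
-/

set_option linter.style.longLine false

noncomputable section

namespace Summit.NavierStokesRegularity.TurbBounds.CouplingSplit

open Polynomial intervalIntegral MeasureTheory Finset Literature.Analysis.SpecialFunctions
open Summit.NavierStokesRegularity.TurbBounds.LadderTail (w w_pos)
open Summit.NavierStokesRegularity.TurbBounds.LegendreCoeffs
open Summit.NavierStokesRegularity.TurbBounds.LegendreTriple
open Summit.NavierStokesRegularity.TurbBounds.LegendreTails

/-- Coupling weight of the mode pair `(n, m)` through the profile with Legendre data `ĝ_0..ĝ_P`: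
`Σ_{p ≤ P} ĝ_p · w_m · T(p,n,m) = Σ_p ĝ_p Λ(n,m,p)`. -/
def pairWeight (P : ℕ) (ĝ : ℕ → ℝ) (n m : ℕ) : ℝ := ∑ p ∈ range (P + 1), ĝ p * (w m * (tripleCoeff p n m : ℝ))

/-- `pairWeight = 0` for `n ≤ N < N + P < m`. -/
theorem pairWeight_eq_zero_of_far {P N n m : ℕ} (ĝ : ℕ → ℝ) (hn : n ≤ N) (hm : N + P < m) : pairWeight P ĝ n m = 0 := by
  unfold pairWeight
  refine sum_eq_zero fun p hp => ?_
  rw [tripleCoeff_eq_zero_of_far (P := P) (by rw [mem_range] at hp; omega) hn hm]; simp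

/-- `pairWeight = 0` for `m ≤ N < N + P < n`. -/
theorem pairWeight_eq_zero_of_far' {P N n m : ℕ} (ĝ : ℕ → ℝ) (hm : m ≤ N) (hn : N + P < n) : pairWeight P ĝ n m = 0 := by
  unfold pairWeight
  refine sum_eq_zero fun p hp => ?_
  rw [tripleCoeff_eq_zero_of_far' (P := P) (by rw [mem_range] at hp; omega) hm hn]; simp

/-- `∫ g·P_n·P_m = pairWeight P ĝ n m` for `g` of degree `≤ P` with Legendre data `ĝ = ĉ(g)`. -/
theorem integral_g_legendre_legendre (gp : ℝ[X]) {P : ℕ} (hg : gp.natDegree ≤ P) (n m : ℕ) :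
    ∫ x in (-1 : ℝ)..1, gp.eval x * (legendre n).eval x * (legendre m).eval x = pairWeight P (legCoeff gp) n m := by
  have hexp : ∀ x, gp.eval x * (legendre n).eval x * (legendre m).eval x
      = ∑ p ∈ range (P + 1), legCoeff gp p * ((legendre p).eval x * (legendre n).eval x * (legendre m).eval x) := by
    intro x
    conv_lhs => rw [eq_sum_legCoeff gp hg]
    rw [eval_finsetSum, sum_mul, sum_mul]
    refine sum_congr rfl fun p _ => ?_
    rw [eval_mul, eval_C]; ring
  simp_rw [hexp]
  rw [intervalIntegral.integral_finsetSum (fun p _ => Continuous.intervalIntegrable (by fun_prop) _ _)]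
  unfold pairWeight
  refine sum_congr rfl fun p _ => ?_
  rw [intervalIntegral.integral_const_mul, integral_legendre_triple]

/-- `∫ g·V·Θ` fully expanded in Legendre coefficients over any window `R` beyond the degrees of `V, Θ`. -/
theorem integral_g_mul_mul (gp Vp Θp : ℝ[X]) {P R : ℕ} (hg : gp.natDegree ≤ P) (hV : Vp.natDegree < R) (hΘ : Θp.natDegree < R) :
    ∫ x in (-1 : ℝ)..1, gp.eval x * Vp.eval x * Θp.eval x
      = ∑ n ∈ range R, ∑ m ∈ range R, legCoeff Vp n * legCoeff Θp m * pairWeight P (legCoeff gp) n m := by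
  obtain ⟨R', rfl⟩ : ∃ R', R = R' + 1 := ⟨R - 1, by omega⟩
  have hexp : ∀ x, gp.eval x * Vp.eval x * Θp.eval x
      = ∑ n ∈ range (R' + 1), ∑ m ∈ range (R' + 1),
          legCoeff Vp n * legCoeff Θp m * (gp.eval x * (legendre n).eval x * (legendre m).eval x) := by
    intro x
    conv_lhs => rw [eq_sum_legCoeff Vp (N := R') (by omega), eq_sum_legCoeff Θp (N := R') (by omega)]
    rw [eval_finsetSum, eval_finsetSum,
      mul_sum (range (R' + 1)) (fun i => (C (legCoeff Vp i) * legendre i).eval x) (gp.eval x), sum_mul]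
    refine sum_congr rfl fun n _ => ?_
    rw [mul_sum]
    refine sum_congr rfl fun m _ => ?_
    rw [eval_mul, eval_C, eval_mul, eval_C]; ring
  simp_rw [hexp]
  rw [intervalIntegral.integral_finsetSum (fun n _ => ?_)]
  · refine sum_congr rfl fun n _ => ?_
    rw [intervalIntegral.integral_finsetSum (fun m _ => Continuous.intervalIntegrable (by fun_prop) _ _)]
    refine sum_congr rfl fun m _ => ?_
    rw [intervalIntegral.integral_const_mul, integral_g_legendre_legendre gp hg]
  · exact (continuous_finsetSum _ fun m _ => by fun_prop).intervalIntegrable _ _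

/-- **The exact tracked part of the coupling** (index set `S` of rbsdp SPEC 3.5): pairs `n, m ≤ N + P` with `n ≤ N` or `m ≤ N`. -/
def couplingExact (N P : ℕ) (ĝ b e : ℕ → ℝ) : ℝ :=
  ∑ n ∈ range (N + P + 1), ∑ m ∈ range (N + P + 1), if n ≤ N ∨ m ≤ N then b n * e m * pairWeight P ĝ n m else 0

/-- Double-sum window reduction: terms vanishing outside `[0, M)²` may be dropped. -/
private theorem sum_sum_range_add_eq {F : ℕ → ℕ → ℝ} {M D : ℕ}
    (h1 : ∀ n m, M ≤ n → F n m = 0) (h2 : ∀ n m, M ≤ m → F n m = 0) :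
    ∑ n ∈ range (M + D), ∑ m ∈ range (M + D), F n m = ∑ n ∈ range M, ∑ m ∈ range M, F n m := by
  rw [sum_range_add]
  have hz : ∑ k ∈ range D, ∑ m ∈ range (M + D), F (M + k) m = 0 :=
    sum_eq_zero fun k _ => sum_eq_zero fun m _ => h1 _ _ (by omega)
  rw [hz, add_zero]
  refine sum_congr rfl fun n _ => ?_
  rw [sum_range_add]
  have hz2 : ∑ k ∈ range D, F n (M + k) = 0 := sum_eq_zero fun k _ => h2 _ _ (by omega)
  rw [hz2, add_zero]

/-- **Coupling split** (rbsdp SPEC 3.5, bilinearity): `∫ g V Θ = couplingExact + ∫ g·w̃₀·θ̃₀`. -/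
theorem coupling_split (N P : ℕ) (gp Vp Θp : ℝ[X]) (hg : gp.natDegree ≤ P) :
    ∫ x in (-1 : ℝ)..1, gp.eval x * Vp.eval x * Θp.eval x
      = couplingExact N P (legCoeff gp) (legCoeff Vp) (legCoeff Θp)
        + ∫ x in (-1 : ℝ)..1, gp.eval x * (legTail N Vp).eval x * (legTail N Θp).eval x := by
  set D := max Vp.natDegree Θp.natDegree + 1 with hD
  set M := N + P + 1 with hM
  have hV : Vp.natDegree < M + D := by omega
  have hΘ : Θp.natDegree < M + D := by omega
  have hVt : (legTail N Vp).natDegree < M + D := lt_of_le_of_lt (natDegree_legTail_le N Vp) (by omega)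
  have hΘt : (legTail N Θp).natDegree < M + D := lt_of_le_of_lt (natDegree_legTail_le N Θp) (by omega)
  rw [integral_g_mul_mul gp Vp Θp hg hV hΘ, integral_g_mul_mul gp _ _ hg hVt hΘt]
  simp_rw [legCoeff_legTail]
  -- difference of the two double sums = the `S`-restricted sum over the big window
  have hdiff : ∑ n ∈ range (M + D), ∑ m ∈ range (M + D), legCoeff Vp n * legCoeff Θp m * pairWeight P (legCoeff gp) n m
      = (∑ n ∈ range (M + D), ∑ m ∈ range (M + D),
          if n ≤ N ∨ m ≤ N then legCoeff Vp n * legCoeff Θp m * pairWeight P (legCoeff gp) n m else 0)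
        + ∑ n ∈ range (M + D), ∑ m ∈ range (M + D),
          (if n ≤ N then 0 else legCoeff Vp n) * (if m ≤ N then 0 else legCoeff Θp m) * pairWeight P (legCoeff gp) n m := by
    rw [← sum_add_distrib]
    refine sum_congr rfl fun n _ => ?_
    rw [← sum_add_distrib]
    refine sum_congr rfl fun m _ => ?_
    by_cases hn : n ≤ N
    · simp [hn]
    · by_cases hm : m ≤ N
      · simp [hn, hm]
      · simp [hn, hm]
  rw [hdiff]
  congr 1
  -- reduce the window of the `S`-sum to `[0, N+P]²`
  unfold couplingExact
  rw [← hM]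
  refine sum_sum_range_add_eq (fun n m hn => ?_) (fun n m hm => ?_)
  · by_cases h : n ≤ N ∨ m ≤ N
    · rw [if_pos h]
      have hm : m ≤ N := by rcases h with h | h <;> omega
      rw [pairWeight_eq_zero_of_far' (legCoeff gp) hm (by omega)]; ring
    · rw [if_neg h]
  · by_cases h : n ≤ N ∨ m ≤ N
    · rw [if_pos h]
      have hn : n ≤ N := by rcases h with h | h <;> omega
      rw [pairWeight_eq_zero_of_far (legCoeff gp) hn (by omega)]; ring
    · rw [if_neg h]

/-- The per-profile-mode part of the exact coupling: `C_p(b,e) = Σ_{(n,m)∈S} b_n e_m · w_m · T(p,n,m)`. -/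
def couplingMode (N P p : ℕ) (b e : ℕ → ℝ) : ℝ :=
  ∑ n ∈ range (N + P + 1), ∑ m ∈ range (N + P + 1), if n ≤ N ∨ m ≤ N then b n * e m * (w m * (tripleCoeff p n m : ℝ)) else 0

/-- `couplingExact = Σ_{p ≤ P} ĝ_p · C_p` (the profile data enter linearly, mode by mode). -/
theorem couplingExact_eq_sum_modes (N P : ℕ) (ĝ b e : ℕ → ℝ) :
    couplingExact N P ĝ b e = ∑ p ∈ range (P + 1), ĝ p * couplingMode N P p b e := by
  unfold couplingExact couplingMode pairWeight
  conv_rhs =>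
    arg 2; ext p; rw [mul_sum]; arg 2; ext n; rw [mul_sum]
  conv_rhs => rw [sum_comm]
  refine sum_congr rfl fun n _ => ?_
  rw [sum_comm]
  refine sum_congr rfl fun m _ => ?_
  split_ifs with h
  · rw [mul_sum]
    exact sum_congr rfl fun p _ => by ring
  · simp

/-- `couplingMode N P p` depends on `b, e` only through their values below `N + P + 1`. -/
theorem couplingMode_congr {N P p : ℕ} {b b' e e' : ℕ → ℝ} (hb : ∀ n < N + P + 1, b n = b' n) (he : ∀ m < N + P + 1, e m = e' m) :
    couplingMode N P p b e = couplingMode N P p b' e' := by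
  unfold couplingMode
  refine sum_congr rfl fun n hn => sum_congr rfl fun m hm => ?_
  rw [hb n (mem_range.mp hn), he m (mem_range.mp hm)]

end Summit.NavierStokesRegularity.TurbBounds.CouplingSplit

end
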